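/-
Copyright: public-audit package `pub-balaban` (b2b-balaban), seat b06-g8. Released under Apache 2.0 like Mathlib.
-/
import Literature.MathematicalPhysics.QuantumFieldTheory.Balaban1983to89.B6LayerTensor

/-!
# B6 Lemma 2.4 with the PRINTED constant 1/(12d²), for every block size L

Source under audit: T. Bałaban, *Propagators and renormalization transformations for lattice gauge theories.
II*, Commun. Math. Phys. **96** (1984) 223–250 [B6], Lemma 2.4, pp. 244–245.  Companion of `B6Lemma24Carrier`
(the concrete carriers, `B6.Lemma24K`), `B6Lemma24Assembly` / `B6Lemma24Kappa` (Lemma 2.4 with the constants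
κ₀/(12d²), κ/(12d²) under `LayerIneq d L κ`) and `B6LayerTensor` (`LayerIneq d L 1 ↔ L ≤ 9`); the single import
`B6LayerTensor` carries the whole chain `B6Lemma24Kappa` → `B6LayerUpperBound` → `B6LayerRayleigh` → `B6LayerDimTwo`.

## The printed statement (verbatim, p. 245)

*"Lemma 2.4. Let a set Λ ⊂ Z^d be a sum of blocks, Λ = B(Λ′). We denote by Λ also a set of bonds b such that at
least one of the end-points b₋, b₊ belongs to Λ. Let B be a configuration defined on Λ and satisfying the
condition (2.121): B(Γ_{y,x}) = 0 for x ∈ B(y), y ∈ Λ′. We put B = 0 outside Λ. Then the following inequality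
holds  L^{d−2} Σ_{c∈Λ′} |(Q₁B)(c)|² + Σ_p |(∂₁B)(p)|² ≥ (1/(12d²)) L^{−d−1} ‖B‖².  (2.128)"*

In the tree this is `B6.Lemma24Printed d L fam` (= `B6.Lemma24K d L 1 fam`, `B6.lemma24K_one_iff`), typed over
abstract tree data; the concrete lattice carriers are `B6Lemma24Carrier.carrier L Λ′ (q1Of L Λ′)` (Q₁-term = the
printed display (2.125)).

## Status before this file

The printed DERIVATION of (2.128) goes through the sentence of p. 245 *"This quadratic form is bounded from below
by L^{−d−1} Σ_{x∈Δ′} |B_μ(x)|², hence"* (2.127), which is false as printed for L ≥ 10 (`B6.ineq2127_fails_L10`;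
`B6LayerTensor.layerIneq_one_iff`: the sentence, `LayerIneq d L 1`, holds iff L ≤ 9).  What the tree had for the
concrete carriers: Lemma 2.4 with constants κ₀/(12d²), κ₁/(12d²) (`B6Lemma24Assembly.lemma24K`,
`B6Lemma24Kappa.lemma24K_kappa1`, κ₁ = 2/(2 + (d−1)(L−1)) → 0 as L → ∞), the d-independent window for the
admissible layer constants (`B6LayerWindow.layerIneq_lower`: min{1, 8/L}; `B6LayerUpperBound.layerIneq_le`: ≤ 12/(L+1);
`B6LayerOptimal.kappaOpt`), and the printed constant only for L ≤ 9
(`B6LayerTensor.layerIneq_of_le_nine` + `B6Lemma24Kappa.lemma24K_K`; `DagDischarged` v5 §LeafB6SmallBlocks).  Census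
G-B6-10 (certifying G-B6-09R): "the printed Lemma 2.4 is UNPROVED AS PRINTED for L ≥ 10 (its printed route is false
at (2.127)) but numerically true with a large margin" — L ≥ 10 is the regime of the series (L a large odd integer).

## What this file proves (all new declarations [folklore]: elementary lattice combinatorics and algebra)

**`lemma24Printed_carrier`: `B6.Lemma24Printed d L (fun i => carrier L (Λ′ i) (q1Of L (Λ′ i)))` for EVERY d ≥ 2
and EVERY L ≥ 1** (Λ′ i ⊂ LZ^d finite) — the printed inequality (2.128) with the printed constant 1/(12d²), for the
concrete carriers, by a route that does not use the refuted sentence: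

* §1 `layer_sq_le` — a LAYER-RESTRICTED form of the tree-gauge Poincaré inequality of p. 244: in the gauge
  (2.121) on B(y), for every coordinate direction ν and every value a,
  Σ_{b⊂B(y), b₋ in the hyperplane x_ν = a, b ⊥ e_ν} |B(b)|² ≤ (d−1)(L−1)L^{d−2} Σ_{p⊂B(y)} |(∂₁B)(p)|².
  It is the printed comb telescoping (`B6TreeGaugePoincare.bond_sq_le`, p. 244 *"|B(x, x+e_j)|² ≦ (|x₁ − y₁| +
  … + |x_{j−1} − y_{j−1}|) Σ |(∂₁B)(p(x′))|²"*) with the plaquette multiplicity counted over the bonds of ONE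
  hyperplane only: at most L^{d−2} bonds of the hyperplane per plaquette (`card_onSeg_layer_le`, an explicit
  injection) instead of the (L−1)L^{j} of the whole block (`B6TreeGaugePoincare.card_onSeg_le`, behind p. 244 *"The
  worst situation is for j = d and it is easy to see that Σ_{x:⟨x,x+e_d⟩⊂B(y)} |B(x, x+e_d)|² ≦ (d−1)(L−1)²L^{d−2}
  Σ′_d |(∂₁B)(p)|²"*) — one factor (L−1) better than (2.123) on a boundary layer, which is what the budget needs.
* §2 bookkeeping over the coarse bonds meeting Λ′ (as in `B6Lemma24Assembly`): the tangential layer sums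
  Σ_{b⊂Δ′}|B(b)|², Σ_{b⊂Δ″}|B(b)|² of (2.124), summed over c, are ≤ (d−1)(L−1)L^{d−2}·d·P_in (`sum_layerLast_le`,
  `sum_layerFirst_le`).
* §3 `face_split` — per coarse bond c = ⟨y, y + Le_μ⟩: the face sum is split EXACTLY,
  L^{−d−1} Σ_{x∈Δ′}|B_μ(x)|² = L^{−d−1} Σ_{Δ′}|B_μ − m|² + (L^{−d} Σ_{Δ′} B_μ)²  (m the mean over Δ′, #Δ′ = L^{d−1});
  the mean part is exactly the square that (2.125) (`B6AveragingBound.ineq2125`) bounds by 3|(Q₁B)(c)|² +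
  3L^{−d}[Σ_{b⊂B(c₋)} + Σ_{b⊂B(c₊)}]|B(b)|², so it costs NO layer constant; only the fluctuation pays one, through
  `LayerIneq d L κ` applied to the mean-zero function B_μ − m (its mean term vanishes) and (2.124)
  (`B6FaceInterpolation.ineq2124`):
  L^{−d−1} Σ_{Δ′}|B_μ|² ≤ 3|(Q₁B)(c)|² + 3L^{−d}[Σ_{b⊂B(c₋)} + Σ_{b⊂B(c₊)}]|B(b)|²
      + (3/κ) L^{−d} [Σ_{b⊂Δ′}|(∂₁B)(p(b))|² + Σ_{b⊂Δ′}|B(b)|² + Σ_{b⊂Δ″}|B(b)|²].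
* §4 the constant κ = κ₁(2, L) = 2/(L+1), valid in EVERY dimension d ≥ 2 (`B6Lemma24Kappa.layerIneq_kappa1` at
  d = 2 transported by `B6LayerTensor.layerIneq_iff_two`; 3/κ = 3(L+1)/2), and the scalar assembly `assembly_core_one`
  with weight 1/(12d²): with (2.123) summed over the blocks (`ineq2123_rescaled`, L^{−d}N_in ≤ dP_in) the
  P_in-coefficient is (6d+1)d + 3d(d−1)(1 − L^{−2}) ≤ 9d² − 2d < 12d², the coefficient of Σ_c|(Q₁B)(c)|² is
  3 ≤ 12d²L^{d−2}, that of P_cr is 3(L+1)L^{−d}/2 ≤ 3 ≤ 12d².  Hence `lemma24_one` (one region, tree-gauge form),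
  `lemma24Printed_carrier` (the typed printed node for every family of carriers), `lemma24K_carrier_of_le_one`
  (`B6.Lemma24K d L κ` for every κ ≤ 1), and the printed shapes `lemma24_printedShape_one` /
  `lemma24_printedShape18_one` (‖B‖² and Σ_p over arbitrary finite carriers E ⊇ Λ-bonds, P ⊇ `lamPlaq`, Q₁ verbatim
  resp. the B5 (1.8) three-contour average, (2.121) as printed).

## HONEST SCOPE

What is certified is the printed INEQUALITY (2.128) with its printed constant, for the concrete lattice carriers of
`B6Lemma24Carrier` (bonds with an end-point in Λ, the once-recorded plaquettes near Λ, Q₁ read from (2.125), the tree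
gauge (2.121)) — for all d ≥ 2, L ≥ 1.  Nothing is claimed about the printed derivation: its sentence before (2.127)
stays refuted for L ≥ 10 (G-B6-09, `B6LayerTensor.layerIneq_one_iff`), and the proof given here (layer-restricted
multiplicity + mean/fluctuation split + the layer constant 2/(L+1)) is the cell's, not the paper's (p. 245 *"The
inequalities (2.123) and (2.127) imply many other inequalities. One of them is formulated in"* Lemma 2.4 is all the
print says about the assembly, census G-B6-08).  No hypothesis of any theorem below is a printed claim: the inputs
are the kernel theorems (2.123)–(2.125) of the tree and the layer inequality PROVED for κ = 2/(L+1).  The abstract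
`B6.Lemma24Printed d L fam` for arbitrary `TreeData` is of course not asserted.

Tags: (2.121), (2.123), (2.124), (2.125), (2.128), Lemma 2.4, B6 p.244, B6 p.245.
-/

open Finset

namespace Literature.MathematicalPhysics.QuantumFieldTheory.Balaban1983to89.B6Lemma24Printed

open B6Elimination (block mem_block)
open B6BondElimination (unitVec unitVec_apply add_unitVec_apply add_smul_unitVec_apply treeBonds mem_treeBonds
  contour)
open B6TreeGaugePoincare (Cfg curl innerBonds innerPlaq mem_innerBonds mem_innerBonds_iff mem_innerPlaq bondStarts
  plaqStarts mem_bondStarts mem_plaqStarts OnSeg seg segCurl bond_sq_le sum_seg_le_indicator sum_innerBonds_eq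
  sum_innerPlaq_eq ineq2123_rescaled)
open B6FaceInterpolation (lastLayer firstLayer bondsIn mem_lastLayer mem_firstLayer mem_bondsIn
  dir_ne_of_mem_bondsIn_lastLayer ineq2124)
open B6LayerPoincare (gradSq card_lastLayer)
open B6AveragingBound (ineq2125)
open B6FaceLowerBound (absorb_last absorb_first)
open B6Lemma24Carrier (lamBonds lamPlaq normSq d1Sq nIn pIn carrier coarseBonds q1Term q1Of q1Of_nonneg)
open B6Lemma24Assembly (mem_coarseBonds dvd_of_mem_coarseBonds innerBonds_not_mem_lamBonds faces_le_pCr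
  crossing_cover sum_blockSq_minus_le sum_blockSq_plus_le)
open B6Lemma24PrintedShape (q1 q18 q1Of_eq contourSum treeGauge_of_contour contourSum_eq_zero_of_bondwise
  sum_sq_superset d1Sq_le_sum_superset q18_eq_q1)
open B6LayerPoincarePair (kappa1 kappa1_pos kappa1_le_one)
open B6Lemma24Kappa (LayerIneq layerIneq_kappa1)
open B6LayerUpperBound (kappa1_two)
open B6LayerTensor (layerIneq_iff_two)
open B6 (Lemma24K Lemma24Printed lemma24K_one_iff lemma24K_mono)

section

variable {d : ℕ} {L : ℕ}

/-! ## §1  The layer-restricted tree-gauge Poincaré inequality -/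

/-- The count of `B6TreeGaugePoincare.card_onSeg_le` restricted to ONE hyperplane: a plaquette parallel to
(e_j, e_μ), j < μ, with lowest corner z lies on the j-th comb segment of at most L^{d−2} bonds ⟨x, x + e_μ⟩ ⊂ B(y)
whose starting point has prescribed ν-th coordinate x_ν = a (ν ≠ μ): the coordinates of x other than x_ν = a and
x_μ = z_μ are at most d − 2 free block coordinates (explicit injection into functions on `univ \ {ν, μ}`). [folklore] -/
theorem card_onSeg_layer_le {y z : Fin d → ℤ} {j μ ν : Fin d} (hjμ : j < μ) (hνμ : ν ≠ μ) (a : ℤ) :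
    #((bondStarts L y μ).filter fun x => x ν = a ∧ OnSeg j x z) ≤ L ^ (d - 2) := by
  classical
  set I : Finset (Fin d) := univ \ {ν, μ} with hI
  set T : Finset ((i : Fin d) → i ∈ I → ℕ) := I.pi fun _ => range L with hT
  have hIc : #I = d - 2 := by
    rw [hI, card_univ_sdiff, Fintype.card_fin, card_pair hνμ]
  have hTc : #T = L ^ (d - 2) := by
    rw [hT, card_pi, prod_const, card_range, hIc]
  set ψ : (Fin d → ℤ) → ((i : Fin d) → i ∈ I → ℕ) := fun x i _ => (x i - y i).toNat with hψ
  rw [← hTc]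
  refine card_le_card_of_injOn ψ (fun x hx => ?_) (fun x hx x' hx' h => ?_)
  · rw [mem_coe, mem_filter, mem_bondStarts] at hx
    obtain ⟨⟨hxb, -⟩, -⟩ := hx
    have hb := mem_block.1 hxb
    rw [hT, mem_coe, mem_pi]
    intro i _
    have := hb i
    simp only [hψ, mem_range]
    omega
  · rw [mem_coe, mem_filter, mem_bondStarts] at hx hx'
    obtain ⟨⟨hxb, -⟩, hxa, hafter, -⟩ := hx
    obtain ⟨⟨hxb', -⟩, hxa', hafter', -⟩ := hx'
    have hb := mem_block.1 hxb
    have hb' := mem_block.1 hxb'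
    funext i
    by_cases hi : i ∈ I
    · have := congrFun (congrFun h i) hi
      have h3 := hb i
      have h4 := hb' i
      simp only [hψ] at this
      omega
    · have hi' : i = ν ∨ i = μ := by
        by_contra hc
        exact hi (by rw [hI, mem_sdiff, mem_insert, mem_singleton]; exact ⟨mem_univ _, hc⟩)
      rcases hi' with rfl | rfl
      · rw [hxa, hxa']
      · rw [← hafter _ hjμ, ← hafter' _ hjμ]

/-- The layer-restricted multiplicity bound, summed: over the bonds ⟨x, x + e_μ⟩ ⊂ B(y) with x_ν = a (ν ≠ μ),
Σ_x Σ_{x′ on the j-th comb segment of x} F(x′) ≤ L^{d−2} Σ_{z : p(z)⊂B(y) ∥ (e_j,e_μ)} F(z), F ≥ 0. [folklore] -/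
theorem multiplicity_layer_le {y : Fin d → ℤ} {j μ ν : Fin d} (hjμ : j < μ) (hνμ : ν ≠ μ) (a : ℤ)
    (F : (Fin d → ℤ) → ℝ) (hF : ∀ z, 0 ≤ F z) :
    ∑ x ∈ (bondStarts L y μ).filter (fun x => x ν = a), ∑ s ∈ range (x j - y j).toNat, F (seg y x j (y j + s)) ≤
      ((L ^ (d - 2) : ℕ) : ℝ) * ∑ z ∈ plaqStarts L y j μ, F z := by
  classical
  calc ∑ x ∈ (bondStarts L y μ).filter (fun x => x ν = a), ∑ s ∈ range (x j - y j).toNat, F (seg y x j (y j + s))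
      ≤ ∑ x ∈ (bondStarts L y μ).filter (fun x => x ν = a), ∑ z ∈ plaqStarts L y j μ,
          if OnSeg j x z then F z else 0 :=
        sum_le_sum fun x hx =>
          sum_seg_le_indicator (mem_bondStarts.1 (mem_filter.1 hx).1).1 hjμ
            (mem_bondStarts.1 (mem_filter.1 hx).1).2 F hF
    _ = ∑ z ∈ plaqStarts L y j μ, (#((bondStarts L y μ).filter fun x => x ν = a ∧ OnSeg j x z) : ℝ) * F z := by
        rw [sum_comm]
        refine sum_congr rfl fun z _ => ?_
        rw [← sum_filter, filter_filter, sum_const, nsmul_eq_mul]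
    _ ≤ ∑ z ∈ plaqStarts L y j μ, ((L ^ (d - 2) : ℕ) : ℝ) * F z :=
        sum_le_sum fun z _ =>
          mul_le_mul_of_nonneg_right (by exact_mod_cast card_onSeg_layer_le hjμ hνμ a) (hF z)
    _ = _ := by rw [mul_sum]

/-- One direction μ ≠ ν of the hyperplane x_ν = a of B(y), tree gauge (2.121) on B(y):
Σ_{⟨x,x+e_μ⟩⊂B(y), x_ν = a} |B(x, x + e_μ)|² ≤ (d−1)(L−1)L^{d−2} Σ_{j<μ} Σ_{p⊂B(y) ∥ (e_j,e_μ)} |(∂₁B)(p)|² — per bond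
the printed Cauchy–Schwarz of p. 244 (`bond_sq_le`), then `multiplicity_layer_le`. [folklore] -/
theorem dirLayer_sq_le (hL : 1 ≤ L) (y : Fin d → ℤ) {μ ν : Fin d} (hνμ : ν ≠ μ) (a : ℤ) (B : Cfg d)
    (hB : ∀ b ∈ treeBonds L y, B b = 0) :
    ∑ x ∈ (bondStarts L y μ).filter (fun x => x ν = a), B (x, μ) ^ 2 ≤
      ((d : ℝ) - 1) * ((L : ℝ) - 1) * (L : ℝ) ^ (d - 2) *
        ∑ j ∈ univ.filter (· < μ), ∑ z ∈ plaqStarts L y j μ, curl B z j μ ^ 2 := by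
  classical
  set J := univ.filter (fun j : Fin d => j < μ) with hJ
  have hL1 : (1 : ℝ) ≤ L := by exact_mod_cast hL
  have hL' : (0 : ℝ) ≤ (L : ℝ) - 1 := by linarith
  have hd' : (0 : ℝ) ≤ (d : ℝ) - 1 := by
    have hd : 1 ≤ d := Nat.succ_le_of_lt (lt_of_le_of_lt (Nat.zero_le _) μ.2)
    have : (1 : ℝ) ≤ d := by exact_mod_cast hd
    linarith
  have hXb : ∀ x ∈ (bondStarts L y μ).filter (fun x => x ν = a), x ∈ block L y ∧ x μ + 1 < y μ + L :=
    fun x hx => mem_bondStarts.1 (mem_filter.1 hx).1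
  have step1 : ∑ x ∈ (bondStarts L y μ).filter (fun x => x ν = a), B (x, μ) ^ 2 ≤
      ((d : ℝ) - 1) * ((L : ℝ) - 1) * ∑ j ∈ J, ∑ x ∈ (bondStarts L y μ).filter (fun x => x ν = a),
        ∑ s ∈ range (x j - y j).toNat, curl B (seg y x j (y j + s)) j μ ^ 2 := by
    calc ∑ x ∈ (bondStarts L y μ).filter (fun x => x ν = a), B (x, μ) ^ 2
        ≤ ∑ x ∈ (bondStarts L y μ).filter (fun x => x ν = a), ((d : ℝ) - 1) * ((L : ℝ) - 1) *
            ∑ j ∈ J, ∑ s ∈ range (x j - y j).toNat, segCurl B y x j μ s ^ 2 :=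
          sum_le_sum fun x hx => bond_sq_le (hXb x hx).1 μ (hXb x hx).2 B hB
      _ = _ := by rw [← mul_sum, sum_comm]; rfl
  have step2 : ∀ j ∈ J, ∑ x ∈ (bondStarts L y μ).filter (fun x => x ν = a), ∑ s ∈ range (x j - y j).toNat,
      curl B (seg y x j (y j + s)) j μ ^ 2 ≤
        (L : ℝ) ^ (d - 2) * ∑ z ∈ plaqStarts L y j μ, curl B z j μ ^ 2 := by
    intro j hj
    have hjμ : j < μ := (mem_filter.1 hj).2
    have h := multiplicity_layer_le (L := L) (y := y) hjμ hνμ a (fun z => curl B z j μ ^ 2) fun z => sq_nonneg _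
    rw [Nat.cast_pow] at h
    exact h
  calc ∑ x ∈ (bondStarts L y μ).filter (fun x => x ν = a), B (x, μ) ^ 2 ≤ _ := step1
    _ ≤ ((d : ℝ) - 1) * ((L : ℝ) - 1) *
          ∑ j ∈ J, ((L : ℝ) ^ (d - 2) * ∑ z ∈ plaqStarts L y j μ, curl B z j μ ^ 2) :=
        mul_le_mul_of_nonneg_left (sum_le_sum step2) (mul_nonneg hd' hL')
    _ = _ := by rw [← mul_sum]; ring

/-- The nonnegativity of the layer constant (d−1)(L−1)L^{d−2} (d, L ≥ 1). [folklore] -/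
theorem layerCoeff_nonneg (hd : 1 ≤ d) (hL : 1 ≤ L) :
    0 ≤ ((d : ℝ) - 1) * ((L : ℝ) - 1) * (L : ℝ) ^ (d - 2) := by
  have hL1 : (1 : ℝ) ≤ L := by exact_mod_cast hL
  have hd1 : (1 : ℝ) ≤ d := by exact_mod_cast hd
  have h1 : (0 : ℝ) ≤ (d : ℝ) - 1 := by linarith
  have h2 : (0 : ℝ) ≤ (L : ℝ) - 1 := by linarith
  exact mul_nonneg (mul_nonneg h1 h2) (pow_nonneg (by linarith) _)

/-- **The layer-restricted tree-gauge Poincaré inequality.**  In the gauge (2.121) on B(y), for every direction ν and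
every a ∈ ℤ: the bonds ⟨x, x + e_μ⟩ ⊂ B(y) with μ ≠ ν starting in the hyperplane x_ν = a carry
Σ |B(b)|² ≤ (d−1)(L−1)L^{d−2} Σ_{p⊂B(y)} |(∂₁B)(p)|² (the plaquette families for different (j, μ) are disjoint,
`sum_innerPlaq_eq`).  For a = y_ν + L − 1 these are the bonds b ⊂ Δ′ of (2.124), for a = y_ν the bonds b ⊂ Δ″ of
the neighbouring face. [folklore] -/
theorem layer_sq_le (hL : 1 ≤ L) (y : Fin d → ℤ) (ν : Fin d) (a : ℤ) (B : Cfg d)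
    (hB : ∀ b ∈ treeBonds L y, B b = 0) :
    ∑ b ∈ (innerBonds L y).filter (fun b => b.1 ν = a ∧ b.2 ≠ ν), B b ^ 2 ≤
      ((d : ℝ) - 1) * ((L : ℝ) - 1) * (L : ℝ) ^ (d - 2) *
        ∑ p ∈ innerPlaq L y, curl B p.1 p.2.1 p.2.2 ^ 2 := by
  classical
  have hd : 1 ≤ d := Nat.succ_le_of_lt (lt_of_le_of_lt (Nat.zero_le _) ν.2)
  rw [sum_filter, sum_innerBonds_eq, sum_innerPlaq_eq y (fun z j μ => curl B z j μ ^ 2), mul_sum]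
  refine sum_le_sum fun μ _ => ?_
  by_cases hμ : μ = ν
  · rw [sum_eq_zero fun x _ => if_neg fun h => h.2 hμ]
    exact mul_nonneg (layerCoeff_nonneg hd hL) (sum_nonneg fun _ _ => sum_nonneg fun _ _ => sq_nonneg _)
  · have e : ∑ x ∈ bondStarts L y μ, (if (x, μ).1 ν = a ∧ (x, μ).2 ≠ ν then B (x, μ) ^ 2 else 0) =
        ∑ x ∈ (bondStarts L y μ).filter (fun x => x ν = a), B (x, μ) ^ 2 := by
      rw [sum_filter]
      exact sum_congr rfl fun x _ => by simp only [hμ, ne_eq, not_false_eq_true, and_true]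
    rw [e]
    exact dirLayer_sq_le hL y (fun h => hμ h.symm) a B hB

/-! ## §2  Bookkeeping: the tangential layer sums of (2.124) over the coarse bonds meeting Λ′ -/

/-- The bonds b ⊂ Δ′ (both end points in the last layer of B(y) in direction ν) are bonds ⊂ B(y) starting in the
hyperplane x_ν = y_ν + L − 1 and transverse to e_ν. [folklore] -/
theorem bondsIn_lastLayer_subset (y : Fin d → ℤ) (ν : Fin d) :
    bondsIn (lastLayer L y ν) ⊆ (innerBonds L y).filter (fun b => b.1 ν = y ν + L - 1 ∧ b.2 ≠ ν) := by
  intro b hb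
  obtain ⟨h1, h2⟩ := mem_bondsIn.1 hb
  obtain ⟨hb1, hν⟩ := mem_lastLayer.1 h1
  exact mem_filter.2
    ⟨mem_innerBonds_iff.2 ⟨hb1, (mem_lastLayer.1 h2).1⟩, hν, dir_ne_of_mem_bondsIn_lastLayer hb⟩

/-- The bonds b ⊂ Δ″ (both end points in the first layer of B(y + Le_ν)) are bonds ⊂ B(y + Le_ν) starting in the
hyperplane x_ν = y_ν + L and transverse to e_ν. [folklore] -/
theorem bondsIn_firstLayer_subset (y : Fin d → ℤ) (ν : Fin d) :
    bondsIn (firstLayer L y ν) ⊆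
      (innerBonds L (y + (L : ℤ) • unitVec ν)).filter (fun b => b.1 ν = y ν + L ∧ b.2 ≠ ν) := by
  intro b hb
  obtain ⟨h1, h2⟩ := mem_bondsIn.1 hb
  obtain ⟨hb1, hν⟩ := mem_firstLayer.1 h1
  obtain ⟨hb2, hν2⟩ := mem_firstLayer.1 h2
  refine mem_filter.2 ⟨mem_innerBonds_iff.2 ⟨hb1, hb2⟩, hν, fun h => ?_⟩
  rw [add_unitVec_apply, if_pos h.symm] at hν2
  omega

/-- Σ over any finite set S of pairs (y, μ) of 1_{y∈Λ′}·Σ_{p⊂B(y)}|(∂₁B)(p)|² is at most d·P_in (each block of Λ′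
occurs for at most d directions). [folklore] -/
theorem sum_ite_blockPlaq_le (Λ' : Finset (Fin d → ℤ)) (B : Cfg d) (S : Finset ((Fin d → ℤ) × Fin d)) :
    ∑ c ∈ S, (if c.1 ∈ Λ' then ∑ p ∈ innerPlaq L c.1, curl B p.1 p.2.1 p.2.2 ^ 2 else 0) ≤
      (d : ℝ) * pIn L Λ' B := by
  classical
  rw [← sum_filter]
  calc ∑ c ∈ S.filter (fun c => c.1 ∈ Λ'), ∑ p ∈ innerPlaq L c.1, curl B p.1 p.2.1 p.2.2 ^ 2
      ≤ ∑ c ∈ Λ' ×ˢ (univ : Finset (Fin d)), ∑ p ∈ innerPlaq L c.1, curl B p.1 p.2.1 p.2.2 ^ 2 :=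
        sum_le_sum_of_subset_of_nonneg (fun c hc => mem_product.2 ⟨(mem_filter.1 hc).2, mem_univ _⟩)
          fun _ _ _ => sum_nonneg fun _ _ => sq_nonneg _
    _ = (d : ℝ) * pIn L Λ' B := by
        rw [sum_product, pIn, mul_sum]
        refine sum_congr rfl fun y _ => ?_
        dsimp only
        rw [sum_const, card_univ, Fintype.card_fin, nsmul_eq_mul]

/-- Per coarse bond c = ⟨y, y + Le_μ⟩ meeting Λ′ (B = 0 outside Λ, tree gauge in the blocks of Λ):
Σ_{b⊂Δ′}|B(b)|² ≤ (d−1)(L−1)L^{d−2}·1_{c₋∈Λ′}·Σ_{p⊂B(c₋)}|(∂₁B)(p)|² (`layer_sq_le` if c₋ ∈ Λ′; if c₋ ∉ Λ′ the block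
B(c₋) ⊄ Λ carries B = 0). [folklore] -/
theorem layerLast_le (hL : 1 ≤ L) {Λ' : Finset (Fin d → ℤ)} (hΛ : ∀ y ∈ Λ', ∀ i, (L : ℤ) ∣ y i) {B : Cfg d}
    (hB0 : ∀ b, b ∉ lamBonds L Λ' → B b = 0) (hT : ∀ y ∈ Λ', ∀ b ∈ treeBonds L y, B b = 0)
    {c : (Fin d → ℤ) × Fin d} (hc : c ∈ coarseBonds L Λ') :
    ∑ b ∈ bondsIn (lastLayer L c.1 c.2), B b ^ 2 ≤
      ((d : ℝ) - 1) * ((L : ℝ) - 1) * (L : ℝ) ^ (d - 2) *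
        (if c.1 ∈ Λ' then ∑ p ∈ innerPlaq L c.1, curl B p.1 p.2.1 p.2.2 ^ 2 else 0) := by
  classical
  have hL0 : 0 < L := Nat.lt_of_lt_of_le Nat.zero_lt_one hL
  split_ifs with h1
  · exact (sum_le_sum_of_subset_of_nonneg (bondsIn_lastLayer_subset c.1 c.2) fun _ _ _ => sq_nonneg _).trans
      (layer_sq_le hL c.1 c.2 _ B (hT c.1 h1))
  · rw [mul_zero]
    refine (sum_eq_zero fun b hb => ?_).le
    have hbi : b ∈ innerBonds L c.1 := (mem_filter.1 (bondsIn_lastLayer_subset c.1 c.2 hb)).1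
    rw [hB0 b (innerBonds_not_mem_lamBonds hL0 hΛ h1 (dvd_of_mem_coarseBonds hΛ hc) hbi)]
    ring

/-- The same for the first layer Δ″ ⊂ B(c₊), c₊ = c₋ + Le_μ. [folklore] -/
theorem layerFirst_le (hL : 1 ≤ L) {Λ' : Finset (Fin d → ℤ)} (hΛ : ∀ y ∈ Λ', ∀ i, (L : ℤ) ∣ y i) {B : Cfg d}
    (hB0 : ∀ b, b ∉ lamBonds L Λ' → B b = 0) (hT : ∀ y ∈ Λ', ∀ b ∈ treeBonds L y, B b = 0)
    {c : (Fin d → ℤ) × Fin d} (hc : c ∈ coarseBonds L Λ') :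
    ∑ b ∈ bondsIn (firstLayer L c.1 c.2), B b ^ 2 ≤
      ((d : ℝ) - 1) * ((L : ℝ) - 1) * (L : ℝ) ^ (d - 2) *
        (if c.1 + (L : ℤ) • unitVec c.2 ∈ Λ' then
          ∑ p ∈ innerPlaq L (c.1 + (L : ℤ) • unitVec c.2), curl B p.1 p.2.1 p.2.2 ^ 2 else 0) := by
  classical
  have hL0 : 0 < L := Nat.lt_of_lt_of_le Nat.zero_lt_one hL
  have hdvd : ∀ i, (L : ℤ) ∣ (c.1 + (L : ℤ) • unitVec c.2) i := fun i => by
    rw [add_smul_unitVec_apply]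
    exact dvd_add (dvd_of_mem_coarseBonds hΛ hc i) (by split_ifs <;> simp)
  split_ifs with h1
  · exact (sum_le_sum_of_subset_of_nonneg (bondsIn_firstLayer_subset c.1 c.2) fun _ _ _ => sq_nonneg _).trans
      (layer_sq_le hL _ c.2 _ B (hT _ h1))
  · rw [mul_zero]
    refine (sum_eq_zero fun b hb => ?_).le
    have hbi : b ∈ innerBonds L (c.1 + (L : ℤ) • unitVec c.2) :=
      (mem_filter.1 (bondsIn_firstLayer_subset c.1 c.2 hb)).1
    rw [hB0 b (innerBonds_not_mem_lamBonds hL0 hΛ h1 hdvd hbi)]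
    ring

/-- **Σ_{c meeting Λ′} Σ_{b⊂Δ′(c)} |B(b)|² ≤ (d−1)(L−1)L^{d−2}·d·P_in(B)** (B = 0 outside Λ, (2.121) in the blocks of
Λ). [folklore] -/
theorem sum_layerLast_le (hd : 1 ≤ d) (hL : 1 ≤ L) {Λ' : Finset (Fin d → ℤ)}
    (hΛ : ∀ y ∈ Λ', ∀ i, (L : ℤ) ∣ y i) {B : Cfg d} (hB0 : ∀ b, b ∉ lamBonds L Λ' → B b = 0)
    (hT : ∀ y ∈ Λ', ∀ b ∈ treeBonds L y, B b = 0) :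
    ∑ c ∈ coarseBonds L Λ', ∑ b ∈ bondsIn (lastLayer L c.1 c.2), B b ^ 2 ≤
      ((d : ℝ) - 1) * ((L : ℝ) - 1) * (L : ℝ) ^ (d - 2) * ((d : ℝ) * pIn L Λ' B) := by
  classical
  refine (sum_le_sum fun c hc => layerLast_le hL hΛ hB0 hT hc).trans ?_
  rw [← mul_sum]
  exact mul_le_mul_of_nonneg_left (sum_ite_blockPlaq_le Λ' B _) (layerCoeff_nonneg hd hL)

/-- **Σ_{c meeting Λ′} Σ_{b⊂Δ″(c)} |B(b)|² ≤ (d−1)(L−1)L^{d−2}·d·P_in(B)** (reindexed over c ↦ c₊ as in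
`B6Lemma24Assembly.sum_blockSq_plus_le`). [folklore] -/
theorem sum_layerFirst_le (hd : 1 ≤ d) (hL : 1 ≤ L) {Λ' : Finset (Fin d → ℤ)}
    (hΛ : ∀ y ∈ Λ', ∀ i, (L : ℤ) ∣ y i) {B : Cfg d} (hB0 : ∀ b, b ∉ lamBonds L Λ' → B b = 0)
    (hT : ∀ y ∈ Λ', ∀ b ∈ treeBonds L y, B b = 0) :
    ∑ c ∈ coarseBonds L Λ', ∑ b ∈ bondsIn (firstLayer L c.1 c.2), B b ^ 2 ≤
      ((d : ℝ) - 1) * ((L : ℝ) - 1) * (L : ℝ) ^ (d - 2) * ((d : ℝ) * pIn L Λ' B) := by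
  classical
  refine (sum_le_sum fun c hc => layerFirst_le hL hΛ hB0 hT hc).trans ?_
  rw [← mul_sum]
  refine mul_le_mul_of_nonneg_left ?_ (layerCoeff_nonneg hd hL)
  have hinj : Set.InjOn (fun c : (Fin d → ℤ) × Fin d => (c.1 + (L : ℤ) • unitVec c.2, c.2))
      ↑(coarseBonds L Λ') := by
    rintro ⟨y, μ⟩ - ⟨y', μ'⟩ - h
    simp only [Prod.mk.injEq] at h
    obtain ⟨h1, rfl⟩ := h
    exact Prod.ext (add_right_cancel h1) rfl
  have e : ∑ c ∈ coarseBonds L Λ', (if c.1 + (L : ℤ) • unitVec c.2 ∈ Λ' then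
        ∑ p ∈ innerPlaq L (c.1 + (L : ℤ) • unitVec c.2), curl B p.1 p.2.1 p.2.2 ^ 2 else 0) =
      ∑ c ∈ (coarseBonds L Λ').image (fun c => (c.1 + (L : ℤ) • unitVec c.2, c.2)),
        (if c.1 ∈ Λ' then ∑ p ∈ innerPlaq L c.1, curl B p.1 p.2.1 p.2.2 ^ 2 else 0) := by
    rw [sum_image hinj]
  rw [e]
  exact sum_ite_blockPlaq_le Λ' B _

/-! ## §3  The face inequality: exact mean/fluctuation split per coarse bond -/

/-- Σ_{x∈S}(f(x) − m)² = Σ f² − (Σ f)²/#S and Σ_{x∈S}(f(x) − m) = 0 for the mean m = (Σ_S f)/#S, #S > 0. [folklore] -/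
theorem sum_sq_sub_mean {α : Type*} (S : Finset α) (f : α → ℝ) (hS : (0 : ℝ) < #S) :
    ∑ x ∈ S, (f x - (∑ z ∈ S, f z) / #S) ^ 2 = ∑ x ∈ S, f x ^ 2 - (∑ z ∈ S, f z) ^ 2 / #S ∧
      ∑ x ∈ S, (f x - (∑ z ∈ S, f z) / #S) = 0 := by
  have hS0 : (#S : ℝ) ≠ 0 := hS.ne'
  refine ⟨?_, ?_⟩
  · have h : ∀ x, (f x - (∑ z ∈ S, f z) / #S) ^ 2 =
        f x ^ 2 - (2 * ((∑ z ∈ S, f z) / #S)) * f x + ((∑ z ∈ S, f z) / #S) ^ 2 := fun x => by ring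
    simp only [h, sum_add_distrib, sum_sub_distrib, ← mul_sum, sum_const, nsmul_eq_mul]
    field_simp
    ring
  · rw [sum_sub_distrib, sum_const, nsmul_eq_mul]
    field_simp
    ring

/-- The weight bookkeeping of the mean part: L^{−d−1}·A²/L^{d−1} = (L^{−d}A)² (d ≥ 1, L ≠ 0). [folklore] -/
theorem mean_sq_rescale (hd : 1 ≤ d) (hL : L ≠ 0) (A : ℝ) :
    ((L : ℝ)⁻¹) ^ (d + 1) * (A ^ 2 / ((L ^ (d - 1) : ℕ) : ℝ)) = (((L : ℝ)⁻¹) ^ d * A) ^ 2 := by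
  have hLr : (L : ℝ) ≠ 0 := by exact_mod_cast hL
  obtain ⟨k, rfl⟩ : ∃ k, d = k + 1 := ⟨d - 1, by omega⟩
  rw [Nat.add_sub_cancel, Nat.cast_pow, div_eq_mul_inv, ← inv_pow]
  ring

/-- **The face inequality (one coarse bond c = ⟨y, y + Le_μ⟩, every configuration B).**  Split B_μ on Δ′ into its mean
m and the fluctuation B_μ − m: L^{−d−1} Σ_{Δ′}|B_μ|² = L^{−d−1} Σ_{Δ′}|B_μ − m|² + (L^{−d} Σ_{Δ′} B_μ)² EXACTLY
(#Δ′ = L^{d−1}).  The mean part is (2.125) (`ineq2125`): ≤ 3|(Q₁B)(c)|² + 3L^{−d}[Σ_{b⊂B(c₋)} + Σ_{b⊂B(c₊)}]|B(b)|²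
(`absorb_last/first`); the fluctuation pays the layer constant: κ·L^{−d−1}Σ|B_μ − m|² ≤ L^{−d}·Σ_{b⊂Δ′}|∇B_μ(b)|²
(`LayerIneq d L κ` on the mean-zero function — its mean term vanishes) ≤ (3/κ)L^{−d}[Σ_{b⊂Δ′}|(∂₁B)(p(b))|² +
Σ_{b⊂Δ′}|B(b)|² + Σ_{b⊂Δ″}|B(b)|²] by (2.124) (`ineq2124`). [folklore] -/
theorem face_split (hd : 2 ≤ d) (hL : 1 ≤ L) {κ : ℝ} (hκ : 0 < κ) (hLI : LayerIneq d L κ)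
    (y : Fin d → ℤ) (μ : Fin d) (B : Cfg d) :
    ((L : ℝ)⁻¹) ^ (d + 1) * ∑ x ∈ lastLayer L y μ, B (x, μ) ^ 2 ≤
      3 * q1Term L B (y, μ) +
      3 * ((L : ℝ)⁻¹) ^ d *
        (∑ b ∈ innerBonds L y, B b ^ 2 + ∑ b ∈ innerBonds L (y + (L : ℤ) • unitVec μ), B b ^ 2) +
      3 / κ * ((L : ℝ)⁻¹) ^ d *
        (∑ b ∈ bondsIn (lastLayer L y μ), curl B b.1 b.2 μ ^ 2 +
          ∑ b ∈ bondsIn (lastLayer L y μ), B b ^ 2 + ∑ b ∈ bondsIn (firstLayer L y μ), B b ^ 2) := by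
  have hL0 : L ≠ 0 := by omega
  have hd1 : 1 ≤ d := le_trans (by norm_num) hd
  have hℓ : (0 : ℝ) ≤ ((L : ℝ)⁻¹) ^ d := by positivity
  have hℓ' : (0 : ℝ) ≤ ((L : ℝ)⁻¹) ^ (d + 1) := by positivity
  -- the printed steps (2.124), (2.125) and the absorptions
  have h1 := ineq2124 hL y μ B
  have h2 := ineq2125 hL y μ B
  rw [← mul_sum] at h2
  have h4 := absorb_last (L := L) y μ B
  have h5 := absorb_first (L := L) y μ B
  have hq : q1Term L B (y, μ) =
      (∑ x ∈ block L y, ((L : ℝ)⁻¹) ^ (d + 1) * ∑ t ∈ range L, B (x + (t : ℤ) • unitVec μ, μ)) ^ 2 := rfl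
  -- the mean/fluctuation split
  have hcard : (#(lastLayer L y μ) : ℝ) = ((L ^ (d - 1) : ℕ) : ℝ) := by rw [card_lastLayer hL y μ]
  have hS : (0 : ℝ) < #(lastLayer L y μ) := by
    rw [hcard, Nat.cast_pow]
    exact pow_pos (by exact_mod_cast Nat.pos_of_ne_zero hL0) _
  obtain ⟨hvar, hmean⟩ := sum_sq_sub_mean (lastLayer L y μ) (fun x => B (x, μ)) hS
  have hresc := mean_sq_rescale hd1 hL0 (∑ x ∈ lastLayer L y μ, B (x, μ))
  rw [← hcard] at hresc
  -- the layer inequality on the fluctuation; its mean term vanishes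
  have h3 := hLI y μ (fun z => B (z, μ) - (∑ x ∈ lastLayer L y μ, B (x, μ)) / #(lastLayer L y μ))
  simp only [gradSq, sub_sub_sub_cancel_right, hmean, mul_zero, ne_eq, OfNat.ofNat_ne_zero,
    not_false_eq_true, zero_pow, add_zero] at h3
  -- G ≤ 3 (F + T′ + T″) from (2.124), hence the fluctuation bound
  have hfl : ((L : ℝ)⁻¹) ^ (d + 1) *
      ∑ x ∈ lastLayer L y μ, (B (x, μ) - (∑ z ∈ lastLayer L y μ, B (z, μ)) / #(lastLayer L y μ)) ^ 2 ≤
      3 / κ * ((L : ℝ)⁻¹) ^ d *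
        (∑ b ∈ bondsIn (lastLayer L y μ), curl B b.1 b.2 μ ^ 2 +
          ∑ b ∈ bondsIn (lastLayer L y μ), B b ^ 2 + ∑ b ∈ bondsIn (firstLayer L y μ), B b ^ 2) := by
    rw [show 3 / κ * ((L : ℝ)⁻¹) ^ d *
        (∑ b ∈ bondsIn (lastLayer L y μ), curl B b.1 b.2 μ ^ 2 +
          ∑ b ∈ bondsIn (lastLayer L y μ), B b ^ 2 + ∑ b ∈ bondsIn (firstLayer L y μ), B b ^ 2) =
        ((L : ℝ)⁻¹) ^ d * (3 * (∑ b ∈ bondsIn (lastLayer L y μ), curl B b.1 b.2 μ ^ 2 +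
          ∑ b ∈ bondsIn (lastLayer L y μ), B b ^ 2 + ∑ b ∈ bondsIn (firstLayer L y μ), B b ^ 2)) / κ by ring]
    rw [le_div_iff₀ hκ]
    have h1' := mul_le_mul_of_nonneg_left h1 hℓ
    linarith
  -- the mean part from (2.125)
  have hmn : (((L : ℝ)⁻¹) ^ d * ∑ x ∈ lastLayer L y μ, B (x, μ)) ^ 2 ≤
      3 * q1Term L B (y, μ) + 3 * ((L : ℝ)⁻¹) ^ d *
        (∑ b ∈ innerBonds L y, B b ^ 2 + ∑ b ∈ innerBonds L (y + (L : ℤ) • unitVec μ), B b ^ 2) := by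
    have h4' := mul_le_mul_of_nonneg_left h4 hℓ
    have h5' := mul_le_mul_of_nonneg_left h5 hℓ
    have h6 : (0 : ℝ) ≤ ((L : ℝ)⁻¹) ^ d * ∑ b ∈ bondsIn (lastLayer L y μ), B b ^ 2 :=
      mul_nonneg hℓ (sum_nonneg fun _ _ => sq_nonneg _)
    have h7 : (0 : ℝ) ≤ ((L : ℝ)⁻¹) ^ d * ∑ b ∈ bondsIn (firstLayer L y μ), B b ^ 2 :=
      mul_nonneg hℓ (sum_nonneg fun _ _ => sq_nonneg _)
    rw [hq]
    linarith
  -- the exact split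
  have hsplit : ((L : ℝ)⁻¹) ^ (d + 1) * ∑ x ∈ lastLayer L y μ, B (x, μ) ^ 2 =
      ((L : ℝ)⁻¹) ^ (d + 1) *
        ∑ x ∈ lastLayer L y μ, (B (x, μ) - (∑ z ∈ lastLayer L y μ, B (z, μ)) / #(lastLayer L y μ)) ^ 2 +
      (((L : ℝ)⁻¹) ^ d * ∑ x ∈ lastLayer L y μ, B (x, μ)) ^ 2 := by
    rw [hvar, ← hresc]
    ring
  linarith [hsplit, hfl, hmn]

/-- The face inequality summed over the coarse bonds meeting Λ′. [folklore] -/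
theorem sum_face_split (hd : 2 ≤ d) (hL : 1 ≤ L) {κ : ℝ} (hκ : 0 < κ) (hLI : LayerIneq d L κ)
    (Λ' : Finset (Fin d → ℤ)) (B : Cfg d) :
    ((L : ℝ)⁻¹) ^ (d + 1) * ∑ c ∈ coarseBonds L Λ', ∑ x ∈ lastLayer L c.1 c.2, B (x, c.2) ^ 2 ≤
      3 * q1Of L Λ' B +
      3 * ((L : ℝ)⁻¹) ^ d *
        (∑ c ∈ coarseBonds L Λ', ∑ b ∈ innerBonds L c.1, B b ^ 2 +
          ∑ c ∈ coarseBonds L Λ', ∑ b ∈ innerBonds L (c.1 + (L : ℤ) • unitVec c.2), B b ^ 2) +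
      3 / κ * ((L : ℝ)⁻¹) ^ d *
        (∑ c ∈ coarseBonds L Λ', ∑ b ∈ bondsIn (lastLayer L c.1 c.2), curl B b.1 b.2 c.2 ^ 2 +
          ∑ c ∈ coarseBonds L Λ', ∑ b ∈ bondsIn (lastLayer L c.1 c.2), B b ^ 2 +
          ∑ c ∈ coarseBonds L Λ', ∑ b ∈ bondsIn (firstLayer L c.1 c.2), B b ^ 2) := by
  have h := sum_le_sum fun c (_ : c ∈ coarseBonds L Λ') => face_split hd hL hκ hLI c.1 c.2 B
  refine le_trans (le_of_eq (mul_sum _ _ _)) (h.trans (le_of_eq ?_))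
  simp only [sum_add_distrib, ← mul_sum, Prod.mk.eta]
  rfl

/-! ## §4  The layer constant 2/(L+1) in every dimension, the scalar assembly, Lemma 2.4 as printed -/

/-- **The layer inequality with the constant 2/(L+1) in EVERY dimension d ≥ 2** (L ≥ 1): `LayerIneq d L (κ₁(2, L))` —
the two-dimensional constant κ₁(2, L) (`layerIneq_kappa1` at d = 2: Δ′ is a path) transported to all d by the
tensorisation `B6LayerTensor.layerIneq_iff_two`. [folklore] -/
theorem layerIneq_two_over (hd : 2 ≤ d) (hL : 1 ≤ L) : LayerIneq d L (kappa1 2 L) :=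
  (layerIneq_iff_two hd _).2 (layerIneq_kappa1 le_rfl hL)

/-- The crossing coefficient: (3(L+1)/2)·L^{−d} ≤ 3 (d, L ≥ 1). [folklore] -/
theorem coeff_cr_le (hd : 1 ≤ d) (hL : 1 ≤ L) : 3 * ((L : ℝ) + 1) / 2 * ((L : ℝ)⁻¹) ^ d ≤ 3 := by
  have hL1 : (1 : ℝ) ≤ L := by exact_mod_cast hL
  have hLne : (L : ℝ) ≠ 0 := by positivity
  have hx0 : (0 : ℝ) ≤ (L : ℝ)⁻¹ := by positivity
  have hx1 : (L : ℝ)⁻¹ ≤ 1 := inv_le_one_of_one_le₀ hL1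
  have hxd : ((L : ℝ)⁻¹) ^ d ≤ (L : ℝ)⁻¹ := by
    calc ((L : ℝ)⁻¹) ^ d ≤ ((L : ℝ)⁻¹) ^ 1 := pow_le_pow_of_le_one hx0 hx1 hd
      _ = (L : ℝ)⁻¹ := pow_one _
  have hLx : ((L : ℝ) + 1) * (L : ℝ)⁻¹ = 1 + (L : ℝ)⁻¹ := by
    rw [add_mul, mul_inv_cancel₀ hLne, one_mul]
  have h := mul_le_mul_of_nonneg_left hxd (by positivity : (0 : ℝ) ≤ (L : ℝ) + 1)
  rw [hLx] at h
  linarith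

/-- The tangential-layer coefficient: (3(L+1)/2)·L^{−d}·(d−1)(L−1)L^{d−2} = (3/2)(d−1)(1 − L^{−2}) ≤ (3/2)(d−1)
(d ≥ 2, L ≥ 1). [folklore] -/
theorem coeff_layer_le (hd : 2 ≤ d) (hL : 1 ≤ L) :
    3 * ((L : ℝ) + 1) / 2 * ((L : ℝ)⁻¹) ^ d * (((d : ℝ) - 1) * ((L : ℝ) - 1) * (L : ℝ) ^ (d - 2)) ≤
      3 / 2 * ((d : ℝ) - 1) := by
  have hL1 : (1 : ℝ) ≤ L := by exact_mod_cast hL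
  have hLne : (L : ℝ) ≠ 0 := by positivity
  have hLx : (L : ℝ) * (L : ℝ)⁻¹ = 1 := mul_inv_cancel₀ hLne
  obtain ⟨k, rfl⟩ : ∃ k, d = k + 2 := ⟨d - 2, by omega⟩
  rw [Nat.add_sub_cancel]
  push_cast
  have key : ((L : ℝ) + 1) * ((L : ℝ) - 1) * (L : ℝ) ^ k * ((L : ℝ)⁻¹) ^ (k + 2) = 1 - ((L : ℝ)⁻¹) ^ 2 := by
    have h1 : ((L : ℝ) * (L : ℝ)⁻¹) ^ k = 1 := by rw [hLx, one_pow]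
    calc ((L : ℝ) + 1) * ((L : ℝ) - 1) * (L : ℝ) ^ k * ((L : ℝ)⁻¹) ^ (k + 2)
        = ((L : ℝ) * (L : ℝ)⁻¹) ^ k * (((L : ℝ) * (L : ℝ)⁻¹) ^ 2 - ((L : ℝ)⁻¹) ^ 2) := by ring
      _ = 1 - ((L : ℝ)⁻¹) ^ 2 := by rw [h1, hLx]; ring
  have hk0 : (0 : ℝ) ≤ k := Nat.cast_nonneg k
  have hk : (0 : ℝ) ≤ 3 / 2 * ((k : ℝ) + 2 - 1) := by linarith
  have hsq := mul_nonneg hk (sq_nonneg ((L : ℝ)⁻¹))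
  calc 3 * ((L : ℝ) + 1) / 2 * ((L : ℝ)⁻¹) ^ (k + 2) * (((k : ℝ) + 2 - 1) * ((L : ℝ) - 1) * (L : ℝ) ^ k)
      = 3 / 2 * ((k : ℝ) + 2 - 1) *
          (((L : ℝ) + 1) * ((L : ℝ) - 1) * (L : ℝ) ^ k * ((L : ℝ)⁻¹) ^ (k + 2)) := by ring
    _ = 3 / 2 * ((k : ℝ) + 2 - 1) * (1 - ((L : ℝ)⁻¹) ^ 2) := by rw [key]
    _ ≤ 3 / 2 * ((k : ℝ) + 2 - 1) := by linarith

/-- **The scalar assembly with the printed weight 1/(12d²)** (pure real-number bookkeeping).  Inputs: the coverage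
‖B‖² − N_in ≤ Σ_faces; the summed face inequality with 3/κ = 3(L+1)/2; the block-term bounds N′, N″ ≤ d·N_in; the faces
bound F ≤ P_cr; the tangential-layer bounds T′, T″ ≤ (d−1)(L−1)L^{d−2}·d·P_in; the summed (2.123) L^{−d}N_in ≤ d·P_in.
Output: L^{−d−1}‖B‖² ≤ 12d²(L^{d−2}Q + P_in + P_cr) — the P_in coefficient is (6d+1)d + 3d(d−1)(1 − L^{−2}) ≤ 9d² − 2d,
that of Q is 3 ≤ 12d²L^{d−2}, that of P_cr is 3(L+1)L^{−d}/2 ≤ 3. [folklore] -/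
theorem assembly_core_one (d L : ℕ) (hd : 2 ≤ d) (hL : 1 ≤ L)
    (Nrm Nin Pin Pcr Q Slay N1 N2 F T1 T2 : ℝ)
    (hNin : 0 ≤ Nin) (hPin : 0 ≤ Pin) (hPcr : 0 ≤ Pcr) (hQ : 0 ≤ Q)
    (hC : Nrm - Nin ≤ Slay)
    (hS : ((L : ℝ)⁻¹) ^ (d + 1) * Slay ≤
      3 * Q + 3 * ((L : ℝ)⁻¹) ^ d * (N1 + N2) + 3 * ((L : ℝ) + 1) / 2 * ((L : ℝ)⁻¹) ^ d * (F + T1 + T2))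
    (hN1 : N1 ≤ d * Nin) (hN2 : N2 ≤ d * Nin) (hF : F ≤ Pcr)
    (hT1 : T1 ≤ ((d : ℝ) - 1) * ((L : ℝ) - 1) * (L : ℝ) ^ (d - 2) * ((d : ℝ) * Pin))
    (hT2 : T2 ≤ ((d : ℝ) - 1) * ((L : ℝ) - 1) * (L : ℝ) ^ (d - 2) * ((d : ℝ) * Pin))
    (hII : ((L : ℝ)⁻¹) ^ d * Nin ≤ d * Pin) :
    ((L : ℝ)⁻¹) ^ (d + 1) * Nrm ≤ 12 * (d : ℝ) ^ 2 * ((L : ℝ) ^ (d - 2) * Q + Pin + Pcr) := by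
  have hd1 : 1 ≤ d := le_trans (by norm_num) hd
  have hd' : (2 : ℝ) ≤ d := by exact_mod_cast hd
  have hdd : (4 : ℝ) ≤ (d : ℝ) ^ 2 := by nlinarith
  have hL1 : (1 : ℝ) ≤ L := by exact_mod_cast hL
  have hx0 : (0 : ℝ) ≤ (L : ℝ)⁻¹ := by positivity
  have hx1 : (L : ℝ)⁻¹ ≤ 1 := inv_le_one_of_one_le₀ hL1
  have hxd0 : (0 : ℝ) ≤ ((L : ℝ)⁻¹) ^ d := pow_nonneg hx0 _
  have hxd1 : (0 : ℝ) ≤ ((L : ℝ)⁻¹) ^ (d + 1) := pow_nonneg hx0 _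
  have hxd : ((L : ℝ)⁻¹) ^ (d + 1) ≤ ((L : ℝ)⁻¹) ^ d := pow_le_pow_of_le_one hx0 hx1 (Nat.le_succ d)
  have hLd : (1 : ℝ) ≤ (L : ℝ) ^ (d - 2) := one_le_pow₀ hL1
  have hdP : (0 : ℝ) ≤ (d : ℝ) * Pin := by positivity
  -- coverage
  have a0 := mul_le_mul_of_nonneg_left hC hxd1
  -- L^{-d-1} N_in ≤ L^{-d} N_in ≤ d P_in
  have a1 : ((L : ℝ)⁻¹) ^ (d + 1) * Nin ≤ d * Pin := (mul_le_mul_of_nonneg_right hxd hNin).trans hII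
  -- block terms: 3 L^{-d} (N′ + N″) ≤ 6 d² P_in
  have a2 : ((L : ℝ)⁻¹) ^ d * (N1 + N2) ≤ 2 * (d : ℝ) ^ 2 * Pin := by
    have h := mul_le_mul_of_nonneg_left (add_le_add hN1 hN2) hxd0
    have h' := mul_le_mul_of_nonneg_left hII (by positivity : (0 : ℝ) ≤ d)
    nlinarith [h, h']
  -- crossing plaquettes: (3(L+1)/2) L^{-d} F ≤ 3 P_cr
  have hK0 : (0 : ℝ) ≤ 3 * ((L : ℝ) + 1) / 2 * ((L : ℝ)⁻¹) ^ d := by positivity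
  have a3 : 3 * ((L : ℝ) + 1) / 2 * ((L : ℝ)⁻¹) ^ d * F ≤ 3 * Pcr :=
    (mul_le_mul_of_nonneg_left hF hK0).trans (mul_le_mul_of_nonneg_right (coeff_cr_le hd1 hL) hPcr)
  -- tangential layers: (3(L+1)/2) L^{-d} Tᵢ ≤ (3/2)(d−1) d P_in
  have hτ := coeff_layer_le hd hL
  have a4 : 3 * ((L : ℝ) + 1) / 2 * ((L : ℝ)⁻¹) ^ d * T1 ≤ 3 / 2 * ((d : ℝ) - 1) * ((d : ℝ) * Pin) := by
    refine (mul_le_mul_of_nonneg_left hT1 hK0).trans ?_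
    rw [← mul_assoc]
    exact mul_le_mul_of_nonneg_right hτ hdP
  have a5 : 3 * ((L : ℝ) + 1) / 2 * ((L : ℝ)⁻¹) ^ d * T2 ≤ 3 / 2 * ((d : ℝ) - 1) * ((d : ℝ) * Pin) := by
    refine (mul_le_mul_of_nonneg_left hT2 hK0).trans ?_
    rw [← mul_assoc]
    exact mul_le_mul_of_nonneg_right hτ hdP
  -- Q: 3 ≤ 12 d² L^{d-2}
  have a6 : 3 * Q ≤ 12 * (d : ℝ) ^ 2 * ((L : ℝ) ^ (d - 2) * Q) := by
    have h : (3 : ℝ) ≤ 12 * (d : ℝ) ^ 2 * (L : ℝ) ^ (d - 2) := by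
      calc (3 : ℝ) ≤ 12 * 4 * 1 := by norm_num
        _ ≤ 12 * (d : ℝ) ^ 2 * (L : ℝ) ^ (d - 2) := by gcongr
    have := mul_le_mul_of_nonneg_right h hQ
    linarith
  nlinarith [a0, a1, a2, a3, a4, a5, a6, hS, hd', hPin, hPcr]

/-- **Lemma 2.4 with the PRINTED constant 1/(12d²), one region, tree-gauge form** (d ≥ 2, L ≥ 1, Λ′ ⊂ LZ^d finite,
B = 0 outside Λ, (2.121) in the blocks of Λ):
(1/(12d²))·L^{−d−1}‖B‖² ≤ L^{d−2} Σ_c |(Q₁B)(c)|² + Σ_p |(∂₁B)(p)|², Q₁ read from (2.125).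
[cite: Balaban1984PropagatorsII, Lemma 2.4 (2.128) p.245] -/
theorem lemma24_one (hd : 2 ≤ d) (hL : 1 ≤ L) {Λ' : Finset (Fin d → ℤ)} (hΛ : ∀ y ∈ Λ', ∀ i, (L : ℤ) ∣ y i)
    (B : Cfg d) (hB0 : ∀ b, b ∉ lamBonds L Λ' → B b = 0) (hT : ∀ y ∈ Λ', ∀ b ∈ treeBonds L y, B b = 0) :
    1 / (12 * (d : ℝ) ^ 2) * (L : ℝ) ^ (-((d : ℝ) + 1)) * normSq L Λ' B ≤
      (L : ℝ) ^ ((d : ℝ) - 2) * q1Of L Λ' B + d1Sq L Λ' B := by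
  have hL0 : 0 < L := Nat.lt_of_lt_of_le Nat.zero_lt_one hL
  have hd1 : 1 ≤ d := le_trans (by norm_num) hd
  have hLr : (0 : ℝ) < L := by exact_mod_cast hL0
  have hκ : 0 < kappa1 2 L := kappa1_pos (by norm_num) hL
  have hS := sum_face_split hd hL hκ (layerIneq_two_over hd hL) Λ' B
  have hk : 3 / kappa1 2 L = 3 * ((L : ℝ) + 1) / 2 := by
    rw [kappa1_two]
    field_simp
  rw [hk] at hS
  have hC := crossing_cover hL0 hΛ B
  have hN1 := sum_blockSq_minus_le hL0 hΛ hB0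
  have hN2 := sum_blockSq_plus_le hL0 hΛ hB0
  have hF := faces_le_pCr hL hΛ B
  have hT1 := sum_layerLast_le hd1 hL hΛ hB0 hT
  have hT2 := sum_layerFirst_le hd1 hL hΛ hB0 hT
  have hII : ((L : ℝ)⁻¹) ^ d * nIn L Λ' B ≤ (d : ℝ) * pIn L Λ' B := ineq2123_rescaled hL Λ' B hT
  have hF0 : (0 : ℝ) ≤ ∑ c ∈ coarseBonds L Λ', ∑ b ∈ bondsIn (lastLayer L c.1 c.2), curl B b.1 b.2 c.2 ^ 2 :=
    sum_nonneg fun _ _ => sum_nonneg fun _ _ => sq_nonneg _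
  have core := assembly_core_one d L hd hL (normSq L Λ' B) (nIn L Λ' B) (pIn L Λ' B)
    (d1Sq L Λ' B - pIn L Λ' B) (q1Of L Λ' B) _ _ _ _ _ _
    (sum_nonneg fun _ _ => sum_nonneg fun _ _ => sq_nonneg _)
    (sum_nonneg fun _ _ => sum_nonneg fun _ _ => sq_nonneg _) (hF0.trans hF) (q1Of_nonneg Λ' B)
    hC hS hN1 hN2 hF hT1 hT2 hII
  have e1 : (L : ℝ) ^ (-((d : ℝ) + 1)) = ((L : ℝ)⁻¹) ^ (d + 1) := by
    rw [Real.rpow_neg hLr.le, ← Nat.cast_succ, Real.rpow_natCast, inv_pow]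
  have e2 : (L : ℝ) ^ ((d : ℝ) - 2) = (L : ℝ) ^ (d - 2) := by
    have h2 : ((d - 2 : ℕ) : ℝ) = (d : ℝ) - 2 := by
      rw [Nat.cast_sub hd]; norm_num
    rw [← h2, Real.rpow_natCast]
  have hd0 : (0 : ℝ) < 12 * (d : ℝ) ^ 2 := by
    have : (2 : ℝ) ≤ d := by exact_mod_cast hd
    positivity
  rw [e1, e2, show 1 / (12 * (d : ℝ) ^ 2) * ((L : ℝ)⁻¹) ^ (d + 1) * normSq L Λ' B =
    (((L : ℝ)⁻¹) ^ (d + 1) * normSq L Λ' B) / (12 * (d : ℝ) ^ 2) by ring, div_le_iff₀ hd0]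
  linarith [core]

/-- **The typed printed node `B6.Lemma24Printed` for the concrete carriers, EVERY d ≥ 2 and EVERY L ≥ 1**: for any
family of finite Λ′_i ⊂ LZ^d, the carriers `carrier L (Λ′ i) (q1Of L (Λ′ i))` (bonds with an end-point in Λ, the
plaquettes near Λ counted once, Q₁ verbatim from (2.125), tree gauge (2.121)) satisfy Lemma 2.4 with the printed
constant 1/(12d²) — including the regime L ≥ 10 where the printed sentence before (2.127) is false.
[cite: Balaban1984PropagatorsII, Lemma 2.4 (2.128) p.245] -/
theorem lemma24Printed_carrier {I : Type} (hd : 2 ≤ d) (hL : 1 ≤ L) (Λ' : I → Finset (Fin d → ℤ))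
    (hΛ : ∀ i, ∀ y ∈ Λ' i, ∀ j, (L : ℤ) ∣ y j) :
    Lemma24Printed d (L : ℝ) (fun i => carrier L (Λ' i) (q1Of L (Λ' i))) := by
  intro i B hB
  obtain ⟨hB0, hT⟩ := hB
  exact lemma24_one hd hL (hΛ i) B hB0 hT

/-- The same as `B6.Lemma24K d L 1` (`B6.lemma24K_one_iff`). [cite: Balaban1984PropagatorsII, Lemma 2.4 (2.128) p.245] -/
theorem lemma24K_one_carrier {I : Type} (hd : 2 ≤ d) (hL : 1 ≤ L) (Λ' : I → Finset (Fin d → ℤ))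
    (hΛ : ∀ i, ∀ y ∈ Λ' i, ∀ j, (L : ℤ) ∣ y j) :
    Lemma24K d (L : ℝ) 1 (fun i => carrier L (Λ' i) (q1Of L (Λ' i))) :=
  (lemma24K_one_iff d (L : ℝ) _).2 (lemma24Printed_carrier hd hL Λ' hΛ)

/-- Hence `B6.Lemma24K d L κ` for the concrete carriers for EVERY κ ≤ 1 (in particular the repaired κ_L of
Lemma 2.4′ and every layer constant of `B6Lemma24Kappa`), d ≥ 2, L ≥ 1. [folklore] -/
theorem lemma24K_carrier_of_le_one {I : Type} (hd : 2 ≤ d) (hL : 1 ≤ L) {κ : ℝ} (hκ : κ ≤ 1)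
    (Λ' : I → Finset (Fin d → ℤ)) (hΛ : ∀ i, ∀ y ∈ Λ' i, ∀ j, (L : ℤ) ∣ y j) :
    Lemma24K d (L : ℝ) κ (fun i => carrier L (Λ' i) (q1Of L (Λ' i))) :=
  lemma24K_mono d (L : ℝ) 1 κ (by exact_mod_cast Nat.lt_of_lt_of_le Nat.zero_lt_one hL) hκ _
    (fun _ _ => sum_nonneg fun _ _ => sq_nonneg _) (lemma24K_one_carrier hd hL Λ' hΛ)

/-- **Lemma 2.4 in the printed shape, printed constant** (as `B6Lemma24Kappa.lemma24_printedShape_K` with κ = 1 and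
NO layer hypothesis).  Let d ≥ 2, L ≥ 1, Λ′ ⊂ LZ^d finite, Λ = ⋃_{y∈Λ′}B(y); let B be a bond configuration on Z^d with
B = 0 outside Λ (on every bond with no end-point in Λ) satisfying (2.121): B(Γ_{y,x}) = 0 for x ∈ B(y), y ∈ Λ′
(contour sums, `B6Lemma24PrintedShape.contourSum`).  Then for every finite set E of bonds containing the bonds of Λ
and every finite set P of (once-recorded) plaquettes containing `lamPlaq L Λ′`:
(1/(12d²))·L^{−d−1} Σ_{b∈E}|B(b)|² ≤ L^{d−2} Σ_c |(Q₁B)(c)|² + Σ_{p∈P}|(∂₁B)(p)|², Q₁ verbatim (2.125)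
(`B6Lemma24PrintedShape.q1`), c over the coarse bonds meeting Λ′. [cite: Balaban1984PropagatorsII, Lemma 2.4 (2.128) p.245] -/
theorem lemma24_printedShape_one (hd : 2 ≤ d) (hL : 1 ≤ L) {Λ' : Finset (Fin d → ℤ)}
    (hΛ : ∀ y ∈ Λ', ∀ i, (L : ℤ) ∣ y i) (B : Cfg d) (hB0 : ∀ b, b ∉ lamBonds L Λ' → B b = 0)
    (h2121 : ∀ y ∈ Λ', ∀ x ∈ block L y, contourSum L B y x = 0)
    {E : Finset ((Fin d → ℤ) × Fin d)} (hE : lamBonds L Λ' ⊆ E)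
    {P : Finset ((Fin d → ℤ) × Fin d × Fin d)} (hP : lamPlaq L Λ' ⊆ P) :
    1 / (12 * (d : ℝ) ^ 2) * (L : ℝ) ^ (-((d : ℝ) + 1)) * ∑ b ∈ E, B b ^ 2 ≤
      (L : ℝ) ^ ((d : ℝ) - 2) * ∑ c ∈ coarseBonds L Λ', q1 L B c ^ 2 +
        ∑ p ∈ P, curl B p.1 p.2.1 p.2.2 ^ 2 := by
  rw [sum_sq_superset hB0 hE, ← q1Of_eq]
  exact (lemma24_one hd hL hΛ B hB0 fun y hy => treeGauge_of_contour (h2121 y hy)).trans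
    (add_le_add le_rfl (d1Sq_le_sum_superset Λ' B hP))

/-- The same with (2.121) in its bondwise printed form (p. 244, "B(b) = 0 for b ⊂ Γ_{y,x}") and the B5 (1.8)
three-contour average (`B6Lemma24PrintedShape.q18`) in place of Q₁ (they coincide under the hypotheses,
`B6Lemma24PrintedShape.q18_eq_q1`). [cite: Balaban1984PropagatorsII, (2.121) p.244, (2.128) p.245] -/
theorem lemma24_printedShape18_one (hd : 2 ≤ d) (hL : 1 ≤ L) {Λ' : Finset (Fin d → ℤ)}
    (hΛ : ∀ y ∈ Λ', ∀ i, (L : ℤ) ∣ y i) (B : Cfg d) (hB0 : ∀ b, b ∉ lamBonds L Λ' → B b = 0)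
    (h2121 : ∀ y ∈ Λ', ∀ x ∈ block L y, ∀ b ∈ contour L y x, B b = 0)
    {E : Finset ((Fin d → ℤ) × Fin d)} (hE : lamBonds L Λ' ⊆ E)
    {P : Finset ((Fin d → ℤ) × Fin d × Fin d)} (hP : lamPlaq L Λ' ⊆ P) :
    1 / (12 * (d : ℝ) ^ 2) * (L : ℝ) ^ (-((d : ℝ) + 1)) * ∑ b ∈ E, B b ^ 2 ≤
      (L : ℝ) ^ ((d : ℝ) - 2) * ∑ c ∈ coarseBonds L Λ', q18 L B c ^ 2 +
        ∑ p ∈ P, curl B p.1 p.2.1 p.2.2 ^ 2 := by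
  have hL0 : 0 < L := Nat.lt_of_lt_of_le Nat.zero_lt_one hL
  have hc : ∀ y ∈ Λ', ∀ x ∈ block L y, contourSum L B y x = 0 :=
    fun y hy => contourSum_eq_zero_of_bondwise (h2121 y hy)
  have hT : ∀ y ∈ Λ', ∀ b ∈ treeBonds L y, B b = 0 := fun y hy => treeGauge_of_contour (hc y hy)
  have e : ∑ c ∈ coarseBonds L Λ', q18 L B c ^ 2 = ∑ c ∈ coarseBonds L Λ', q1 L B c ^ 2 :=
    sum_congr rfl fun c hc' => by rw [q18_eq_q1 hL0 hΛ hB0 hT hc']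
  rw [e]
  exact lemma24_printedShape_one hd hL hΛ B hB0 hc hE hP

end

end Literature.MathematicalPhysics.QuantumFieldTheory.Balaban1983to89.B6Lemma24Printed
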